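import Mathlib
import HarnessLib
import Summits.HubbardSuperconductivity.HubbardSuperconductivity.Theorems.KLProgrammeKLRegimeEngineTowerBlockIncrWt
import Summits.HubbardSuperconductivity.HubbardSuperconductivity.Theorems.KLProgrammeKLRegimeEngineTowerModelDefsRate

/-!
# Route `KLProgramme` — crux K3 ENGINE (stmt-HubbardSuperconductivity-20437 `KLRegimeEngineV17F2`), stub (b) v2, THE LEVELS PACKAGE (ℓ):
# (I1′) — the born weighted pinned sums of the tower's block increments AT AN ARBITRARY TREE-WEIGHT RATE (the (K4) target-rate reading)
# (E1-LEVELS-BLUEPRINT-g8 (I1′); E1 lead r2d-p2 g8; answer to k3c3-p2 g10 «(b)-Wt-FAMILY-DEEP»)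

`…EngineTowerBlockIncrWt.klWtPinnedSumOf_klTowerIncr_le` (p577622) reads the born increment `Δ_k` at family `F_{J′}` with the tree weight of the SAME index `J′`
(rate `Λ_{J′}`).  The blocked tower is run once per read-out level `j` and conjunct 2 at level `j` needs only the weight `klScaleWt … j` (rate `Λ_j ≤ Λ_{J′}`);
reading every internal row/overlap/born size at that TARGET rate keeps the suppliers' weighted constants n-free at all internal levels (KL STATUS 2026-08-27T22:11Z (1)).
Since the block-step doors take the tree weight as a free parameter, the same proof gives the rate-decoupled statement in the carrier `klWtPinnedSumAt`
(…EngineTowerModelDefsRate):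

* **`klWtPinnedSumAt_klTowerIncr_le`** — for `1 ≤ d`, `1 ≤ k`, `dk ≤ J′`, ANY rate index `j`, `Z^K_{Λ_{dk}} ≠ 0` and the block constants stated with the weight
  `klScaleWt L M β j`: `klWtPinnedSumAt … J′ j (2(q+1)) Δ_k i w″ ≤ ε_x^{2q+1} · (graded RHS + binomial RHS)`.
Composition of landed theorems; nothing about the model is asserted beyond them; nothing asserts superconductivity.
-/

noncomputable section

namespace Summit.HubbardSuperconductivity.HubbardSuperconductivity.Theorems.EngineV8

set_option linter.dupNamespace false -- summit = problem name (single-conjunct summit), D-0017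

open Real Finset Literature.MathematicalPhysics.QuantumLattice Literature.Probability.LatticeModels GrassmannAlgebra
open Summit.HubbardSuperconductivity.HubbardSuperconductivity.Theorems.KLProgrammeLegKernels
open Summit.HubbardSuperconductivity.HubbardSuperconductivity.Theorems.KLRegimeSplit
open Summit.HubbardSuperconductivity.HubbardSuperconductivity.Theorems.KLRegimeWick
open Summit.HubbardSuperconductivity.HubbardSuperconductivity.Theorems.TwoPointAssembly
open Literature.Probability.LatticeModels.BattleFederbush

variable {L M : ℕ} [NeZero L]

section Born

variable [NeZero M]

/-- **THE BORN WEIGHTED SIZES OF A BLOCK INCREMENT AT AN ARBITRARY RATE** (blueprint (I1′), weighted track, model half, rate index `j` free —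
the (K4) target-rate reading: take `j :=` the read-out level).  `1 ≤ d`, `1 ≤ k`, `dk ≤ J′`, `Z^K_{Λ_{dk}} ≠ 0`; block constants
of …BlockStepWt for the weight `klScaleWt L M β j` and leg maps `latticeLegPos`; weighted input sizes `B m′` of `𝒱_{dk}` at `F_{dk−1}`.  Then in every even
degree `2(q+1)` and at every pin `(i, w″)`:
`klWtPinnedSumAt … J′ j (2(q+1)) Δ_k i w″ ≤ ε_x^{2q+1} · (graded RHS + binomial RHS)`. -/
theorem klWtPinnedSumAt_klTowerIncr_le {β : ℝ} (hβ : 0 < β) (U μ : ℝ) (K : TrigPolyC4v) {d k J' : ℕ} (j : ℕ) (hd : 1 ≤ d) (hk : 1 ≤ k)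
    (hJ' : d * k ≤ J')
    (hZ : hubbardEffPartitionFnCT L M β U μ 0 K (klScale klE0 (d * k)) ≠ 0)
    {κ : ℝ} (hκ : 0 < κ)
    (hGB : IsGramBoundedR ((sectorSubMatrix L M β (bgmFatMultiplier L M klE0 β (nambuXiCT L μ K) (d * k - 1))).transpose *
      hubbardCovSliceCT L M β μ 0 K (klScale klE0 (d * (k + 1))) (klScale klE0 (d * k)) *
        sectorSubMatrix L M β (bgmFatMultiplier L M klE0 β (nambuXiCT L μ K) (d * k - 1))) κ)
    (B : ℕ → ℝ) (hB0 : ∀ m', 0 ≤ B m')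
    (hB : ∀ (m' : ℕ) (t : Fin (2 * m')) (w : SpaceTimeIdx L M × SectorLeg (sectorCount (d * k - 1))),
      ∑ Y ∈ univ.filter (fun Y : Fin (2 * m') → SpaceTimeIdx L M × SectorLeg (sectorCount (d * k - 1)) => Y t = w),
        klScaleWt L M β j ((univ.image Y).image (latticeLegPos (2 * (2 * M)))) *
          ‖kernel ℂ (ExteriorAlgebra.map (Matrix.toLin' (sectorAnalysisMatrix L M β (klAnisoFamily L M β μ K klE0 (d * k - 1))))
            (klTowerInput L M β U μ K d k)) (2 * m') Y‖ ≤ B m')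
    {α : ℝ} (hα : 0 < α)
    (hrow : ∀ X, ∑ Y, ‖((sectorSubMatrix L M β (bgmFatMultiplier L M klE0 β (nambuXiCT L μ K) (d * k - 1))).transpose *
        hubbardCovSliceCT L M β μ 0 K (klScale klE0 (d * (k + 1))) (klScale klE0 (d * k)) *
          sectorSubMatrix L M β (bgmFatMultiplier L M klE0 β (nambuXiCT L μ K) (d * k - 1))) X Y‖ *
        klScaleWt L M β j {latticeLegPos (2 * (2 * M)) X, latticeLegPos (2 * (2 * M)) Y} ≤ α)
    (hcol : ∀ Y, ∑ X, ‖((sectorSubMatrix L M β (bgmFatMultiplier L M klE0 β (nambuXiCT L μ K) (d * k - 1))).transpose *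
        hubbardCovSliceCT L M β μ 0 K (klScale klE0 (d * (k + 1))) (klScale klE0 (d * k)) *
          sectorSubMatrix L M β (bgmFatMultiplier L M klE0 β (nambuXiCT L μ K) (d * k - 1))) X Y‖ *
        klScaleWt L M β j {latticeLegPos (2 * (2 * M)) X, latticeLegPos (2 * (2 * M)) Y} ≤ α)
    {ρ : ℝ} (hρ : 0 < ρ)
    (hθ : Real.exp 1 * α * normV (SpaceTimeIdx L M × SectorLeg (sectorCount (d * k - 1))) κ ρ
      (fun m' => imagTimeWeight β M ^ (2 * m') * B m') / κ ^ 2 < 1)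
    {cr cc : ℝ} (hcc0 : 0 ≤ cc)
    (hrow' : ∀ X'', ∑ X', ‖(sectorAnalysisMatrix L M β (klAnisoFamily L M β μ K klE0 J') *
        sectorSubMatrix L M β (bgmFatMultiplier L M klE0 β (nambuXiCT L μ K) (d * k - 1))) X'' X'‖ *
        klScaleWt L M β j {latticeLegPos (2 * (2 * M)) X'', latticeLegPos (2 * (2 * M)) X'} ≤ cr)
    (hcol' : ∀ X', ∑ X'', ‖(sectorAnalysisMatrix L M β (klAnisoFamily L M β μ K klE0 J') *
        sectorSubMatrix L M β (bgmFatMultiplier L M klE0 β (nambuXiCT L μ K) (d * k - 1))) X'' X'‖ *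
        klScaleWt L M β j {latticeLegPos (2 * (2 * M)) X'', latticeLegPos (2 * (2 * M)) X'} ≤ cc)
    {N₀ : ℕ} (hN₀ : 2 ≤ N₀) (q : ℕ) (i : Fin (2 * (q + 1))) (w'' : SpaceTimeIdx L M × SectorLeg (sectorCount J')) :
    klWtPinnedSumAt L M β μ K J' j (2 * (q + 1)) (klTowerIncr L M β U μ K d k) i w'' ≤
      imagTimeWeight β M ^ (2 * q + 1) *
        (cr * cc ^ (2 * q + 1) *
          (∑ n ∈ Ico 2 N₀, (ρ⁻¹ ^ (2 * q + 1 + 1) * κ⁻¹ ^ (2 * (n - 1)) * (α ^ (n - 1) * Real.exp n)) *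
              ∑ δ ∈ (Fintype.piFinset fun _ : Fin n => range (Fintype.card (SpaceTimeIdx L M × SectorLeg (sectorCount (d * k - 1))) / 2 + 1)) with
                  2 * q + 1 + 1 + 2 * (n - 1) ≤ ∑ a, 2 * δ a,
                ∏ a, (Real.exp 2 * (κ + ρ)) ^ (2 * δ a) * (imagTimeWeight β M ^ (2 * δ a) * B (δ a)) +
            ρ⁻¹ ^ (2 * q + 1 + 1) *
              (Real.exp 1 * normV (SpaceTimeIdx L M × SectorLeg (sectorCount (d * k - 1))) κ ρ (fun m' => imagTimeWeight β M ^ (2 * m') * B m')) *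
              (Real.exp 1 * α * normV (SpaceTimeIdx L M × SectorLeg (sectorCount (d * k - 1))) κ ρ
                  (fun m' => imagTimeWeight β M ^ (2 * m') * B m') / κ ^ 2) ^ (N₀ - 1) /
              (1 - Real.exp 1 * α * normV (SpaceTimeIdx L M × SectorLeg (sectorCount (d * k - 1))) κ ρ
                  (fun m' => imagTimeWeight β M ^ (2 * m') * B m') / κ ^ 2)) +
        cr * cc ^ (2 * q + 1) *
          ∑ m' ∈ range (Fintype.card (SpaceTimeIdx L M × SectorLeg (sectorCount (d * k - 1))) / 2 + 1),
            (if q + 1 < m' then ((2 * m').choose (2 * (q + 1)) : ℝ) * κ ^ (2 * m' - 2 * (q + 1)) *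
              (imagTimeWeight β M ^ (2 * m') * B m') else 0)) := by
  have hβ' : β ≠ 0 := hβ.ne'
  have hJ₁ : 1 ≤ d * k := le_trans hd (Nat.le_mul_of_pos_right d hk)
  have hJ : d * k ≤ d * (k + 1) := Nat.mul_le_mul_left d (Nat.le_succ k)
  have hwt := isTreeWeight_klScaleWt L M hβ.le j
  have hG : klTowerInput L M β U μ K d k ∈ evenPart ℂ (HubbardFieldIdx L M) := klEffectiveAction_mem_evenPart hβ' U μ K klE0 (d * k)
  have hG0 : constPart ℂ (klTowerInput L M β U μ K d k) = 0 := constPart_klEffectiveAction_eq_zero β U μ K klE0 (d * k) hZ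
  have hε : 0 ≤ imagTimeWeight β M := imagTimeWeight_nonneg hβ.le M
  -- split the increment and the pinned sum
  have h2 := blockStep_ordersGe2_wt_le (L := L) (M := M) hwt hβ μ K hJ₁ hJ hJ' (latticeLegPos (2 * (2 * M))) (latticeLegPos (2 * (2 * M)))
    (klTowerInput L M β U μ K d k) hG hG0 hκ hGB B hB0 hB hα hrow hcol hρ hθ hcc0 hrow' hcol' hN₀ (2 * q + 1) i w''
  have h1 := blockStep_firstOrder_wt_le (L := L) (M := M) hwt hβ μ K hJ₁ hJ hJ' (latticeLegPos (2 * (2 * M))) (latticeLegPos (2 * (2 * M)))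
    (klTowerInput L M β U μ K d k) hG hκ.le hGB B hB0 hB hcc0 hrow' hcol' q i w''
  rw [klTowerIncr_eq_ordersGe2_add_firstOrder β U μ K d k hZ]
  refine (klWtPinnedSumAt_add_le hβ.le μ K J' j _ _ _ i w'').trans ?_
  rw [mul_add (imagTimeWeight β M ^ (2 * q + 1))]
  exact add_le_add
    ((klWtPinnedSumAt_succ β μ K J' j (2 * q + 1) _ i w'').trans_le (mul_le_mul_of_nonneg_left h2 (pow_nonneg hε _)))
    ((klWtPinnedSumAt_succ β μ K J' j (2 * q + 1) _ i w'').trans_le (mul_le_mul_of_nonneg_left h1 (pow_nonneg hε _)))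

end Born

end Summit.HubbardSuperconductivity.HubbardSuperconductivity.Theorems.EngineV8

end
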